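import Mathlib
import Summits.NavierStokesRegularity.NavierStokesRegularity.Theorems.SqueezeCycleExtremalBiaxialitySubcriticalGaugeStrainBound
import Summits.NavierStokesRegularity.NavierStokesRegularity.Theorems.RecurrentProfilesRecurrentLiouvilleClockConstantinWindow
import Literature.Analysis.FluidPDE.TypeIAncientMild
import Literature.Analysis.FluidPDE.CurlFreeLiouville
import Literature.Analysis.FluidPDE.ElgindiBlowup
import HarnessLib

/-!
# Crux `RecurrentLiouville` (stmt-NavierStokesRegularity-1589), line `Sketch` (ideator 4, stretching
# clock) — stub `stub_clockSlackLiouville`: the cumulative-slack Liouville theorem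

Theorems-only file.  **Main result** (`stub_clockSlackLiouville`): a Type-I ancient mild field
`v ∈ A_C` (`IsTypeIAncientMild C v`) whose strain form `ξ ↦ ⟪∇v(t,x)ξ, ξ⟫` admits a continuous
majorant `Λ(t)‖ξ‖²` on `t < 0` with CUMULATIVE slack,
`∫_{t₀}^{t₁} Λ ≤ (1 − ε) log(t₀/t₁) + K` on every window `t₀ < t₁ < 0` (some `ε > 0`, `K`),
vanishes identically.  The pointwise no-slack Liouville theorem of route SqueezeCycle
(`stub_noSlackStretching`, p94840: `(−t)⟪∇v e, e⟫ ≤ 1 − ε` everywhere ⇒ `v ≡ 0`) is the case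
`Λ(t) = (1 − ε)/(−t)`, `K = 0`; here only the TIME INTEGRAL of the maximal stretching has to stay
`ε` below the dilution clock `log(t₀/t₁)`.

Proof.  Constantin's window inequality (`stub_clockConstantinWindow`, landed separately) between
`t₀` and `t₁` with the class-uniform gauge pin `‖ω(t₀, ·)‖ ≤ K₁/(−t₀)` (KNSS Prop. 4.1) gives
`‖ω(t₁, x)‖ ≤ K₁ e^K (−t₀)^{−ε} (−t₁)^{ε−1} → 0` as `t₀ → −∞`, so every slice is irrotational,
hence constant (div–curl Liouville for bounded fields, `eq_of_curl_eq_zero_of_isDivFree_of_bounded`),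
and the Oseen gauge kills slice-constant elements (`IsTypeIAncientMild.eq_zero_of_slice_const`).

## References

* P. Constantin, Comm. Math. Phys. 129 (1990) 241–266, (2.9); SIAM Review 36 (1994) 73–98.
* G. Koch, N. Nadirashvili, G. Seregin, V. Šverák, Acta Math. 203 (2009), Prop. 4.1, Lemma 3.1,
  Remark 6.1.
-/

noncomputable section

-- the sub-problem namespace repeats the summit name (D-0017 layout `Summit.<S>.<P>.Theorems`)
set_option linter.dupNamespace false

namespace Summit.NavierStokesRegularity.NavierStokesRegularity.Theorems

open MeasureTheory Set Function Filter Topology TopologicalSpace Metric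
open Literature.Analysis Literature.Analysis.FluidPDE
open scoped NNReal ENNReal RealInnerProductSpace Laplacian

/-- **Upper vorticity pin** (KNSS gauge bound, `exists_gauge_norm_fderiv_le_of_typeI`, and
`‖curl w x‖ ≤ 4‖∇w(x)‖`): `‖curl v(t, x)‖ ≤ K₁(C)/(−t)` on `A_C`, with `K₁ > 0`. -/
theorem clockSL_upper_pin (C : ℝ) :
    ∃ K₁ : ℝ, 0 < K₁ ∧ ∀ ⦃v : ℝ → EuclideanSpace ℝ (Fin 3) → EuclideanSpace ℝ (Fin 3)⦄,
      IsTypeIAncientMild C v → ∀ t < 0, ∀ x, ‖curl (v t) x‖ ≤ K₁ / (-t) := by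
  obtain ⟨K₀, hK₀⟩ := exists_gauge_norm_fderiv_le_of_typeI C
  refine ⟨4 * |K₀| + 1, by positivity, fun v hv t ht x => ?_⟩
  have ht' : 0 < -t := neg_pos.2 ht
  have h1 : ‖curl (v t) x‖ ≤ 4 * ‖fderiv ℝ (v t) x‖ := norm_curl_le_four_mul (v t) x
  have h2 : (-t) * ‖fderiv ℝ (v t) x‖ ≤ K₀ := hK₀ hv t ht x
  rw [le_div_iff₀ ht']
  calc ‖curl (v t) x‖ * -t ≤ 4 * ‖fderiv ℝ (v t) x‖ * -t := by gcongr
    _ = 4 * ((-t) * ‖fderiv ℝ (v t) x‖) := by ring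
    _ ≤ 4 * |K₀| := by nlinarith [le_abs_self K₀]
    _ ≤ 4 * |K₀| + 1 := by linarith

/-- **Cumulative slack kills the vorticity** (the analytic core, with Constantin's window
inequality as an explicit hypothesis `hCW`).  If `‖ω(t₁, x)‖ ≤ A e^{∫Λ}` whenever
`‖ω(t₀, ·)‖ ≤ A` (for all windows), the gauge pin `‖ω(t₀, ·)‖ ≤ K₁/(−t₀)` and the slack
`∫_{t₀}^{t₁} Λ ≤ (1−ε) log(t₀/t₁) + K` give `‖ω(t₁, x)‖ ≤ K₁ e^K (−t₁)^{ε−1} (−t₀)^{−ε}` for every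
`t₀ < t₁`, and `(−t₀)^{−ε} → 0`. -/
theorem clockSL_curl_eq_zero {C : ℝ} {v : ℝ → EuclideanSpace ℝ (Fin 3) → EuclideanSpace ℝ (Fin 3)}
    (hv : IsTypeIAncientMild C v) {Λ : ℝ → ℝ}
    (hCW : ∀ (t₀ t₁ : ℝ), t₀ < t₁ → t₁ < 0 → ∀ (A : ℝ), (∀ y, ‖curl (v t₀) y‖ ≤ A) →
      ∀ x, ‖curl (v t₁) x‖ ≤ A * Real.exp (∫ t in t₀..t₁, Λ t))
    {ε K : ℝ} (hε : 0 < ε)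
    (hslack : ∀ t₀ t₁ : ℝ, t₀ < t₁ → t₁ < 0 →
      ∫ t in t₀..t₁, Λ t ≤ (1 - ε) * Real.log (t₀ / t₁) + K)
    {t₁ : ℝ} (ht₁ : t₁ < 0) (x : EuclideanSpace ℝ (Fin 3)) : curl (v t₁) x = 0 := by
  obtain ⟨K₁, hK₁, hup⟩ := clockSL_upper_pin C
  have ht1 : 0 < -t₁ := neg_pos.2 ht₁
  -- the bound `‖ω(t₁, x)‖ ≤ M · s^{-ε}` for `t₀ = -s`, `s > -t₁`
  set M : ℝ := K₁ * Real.exp K * (-t₁) ^ (ε - 1) with hM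
  have hbound : ∀ s : ℝ, -t₁ < s → ‖curl (v t₁) x‖ ≤ M * s ^ (-ε) := by
    intro s hs
    have hs0 : 0 < s := ht1.trans hs
    have h0s : -s < t₁ := by linarith
    have hA : ∀ y, ‖curl (v (-s)) y‖ ≤ K₁ / s := fun y => by
      have h := hup hv (-s) (by linarith) y
      rwa [neg_neg] at h
    have h1 := hCW (-s) t₁ h0s ht₁ (K₁ / s) hA x
    have h2 := hslack (-s) t₁ h0s ht₁
    have hratio : -s / t₁ = s / (-t₁) := by rw [neg_div, div_neg]
    have hexp : Real.exp (∫ t in (-s)..t₁, Λ t) ≤ (s / (-t₁)) ^ (1 - ε) * Real.exp K := by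
      calc Real.exp (∫ t in (-s)..t₁, Λ t)
          ≤ Real.exp ((1 - ε) * Real.log (-s / t₁) + K) := Real.exp_le_exp.2 h2
        _ = (s / (-t₁)) ^ (1 - ε) * Real.exp K := by
            rw [Real.exp_add, hratio, Real.rpow_def_of_pos (div_pos hs0 ht1), mul_comm (Real.log _)]
    calc ‖curl (v t₁) x‖ ≤ K₁ / s * Real.exp (∫ t in (-s)..t₁, Λ t) := h1
      _ ≤ K₁ / s * ((s / (-t₁)) ^ (1 - ε) * Real.exp K) := by
          gcongr
      _ = M * s ^ (-ε) := by
          have e1 : (s / (-t₁)) ^ (1 - ε) = s * s ^ (-ε) * ((-t₁) ^ (1 - ε))⁻¹ := by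
            rw [Real.div_rpow hs0.le ht1.le, show (1 - ε) = 1 + (-ε) by ring, Real.rpow_add hs0,
              Real.rpow_one]
            ring
          have e2 : (-t₁) ^ (ε - 1) = ((-t₁) ^ (1 - ε))⁻¹ := by
            rw [show ε - 1 = -(1 - ε) by ring, Real.rpow_neg ht1.le]
          rw [hM, e1, e2]
          field_simp
  -- let `s → ∞`
  have hlim : Tendsto (fun s : ℝ => M * s ^ (-ε)) atTop (𝓝 0) := by
    have h := (tendsto_rpow_neg_atTop hε).const_mul M
    rwa [mul_zero] at h
  have hle : ‖curl (v t₁) x‖ ≤ 0 :=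
    ge_of_tendsto hlim ((eventually_gt_atTop (-t₁)).mono fun s hs => hbound s hs)
  exact norm_le_zero_iff.1 hle

/-- **Cumulative-slack Liouville, core form** (Constantin's window inequality as hypothesis):
irrotational slices are constant (div–curl Liouville for bounded `C²` fields) and the Oseen gauge
kills slice-constant elements of the class. -/
theorem clockSL_eq_zero_of_constantin {C : ℝ}
    {v : ℝ → EuclideanSpace ℝ (Fin 3) → EuclideanSpace ℝ (Fin 3)}
    (hv : IsTypeIAncientMild C v) {Λ : ℝ → ℝ}
    (hCW : ∀ (t₀ t₁ : ℝ), t₀ < t₁ → t₁ < 0 → ∀ (A : ℝ), (∀ y, ‖curl (v t₀) y‖ ≤ A) →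
      ∀ x, ‖curl (v t₁) x‖ ≤ A * Real.exp (∫ t in t₀..t₁, Λ t))
    {ε K : ℝ} (hε : 0 < ε)
    (hslack : ∀ t₀ t₁ : ℝ, t₀ < t₁ → t₁ < 0 →
      ∫ t in t₀..t₁, Λ t ≤ (1 - ε) * Real.log (t₀ / t₁) + K) :
    ∀ t : ℝ, t < 0 → ∀ x : EuclideanSpace ℝ (Fin 3), v t x = 0 := by
  have hconst : ∀ t < 0, ∀ x, v t x = v t 0 := fun t ht x =>
    eq_of_curl_eq_zero_of_isDivFree_of_bounded ((hv.contDiff_slice ht).of_le (by norm_cast))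
      (fun y => clockSL_curl_eq_zero hv hCW hε hslack ht y) (hv.isDivFree ht)
      (fun y => hv.norm_le ht y) x 0
  intro t ht x
  exact hv.eq_zero_of_slice_const (b := fun t => v t 0) hconst ht x

/-! ### The registered stub -/

/-- **Cumulative-slack Liouville theorem** (registered stub `stub_clockSlackLiouville` of line
`Sketch`, crux stmt-NavierStokesRegularity-1589).  A Type-I ancient mild field `v ∈ A_C` whose
strain form admits a continuous majorant `Λ` on `t < 0` with cumulative slack —
`∫_{t₀}^{t₁} Λ ≤ (1 − ε) log(t₀/t₁) + K` on every window — vanishes identically: Constantin's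
window inequality (`stub_clockConstantinWindow`, landed) feeds `clockSL_eq_zero_of_constantin`.
[cite: KochNadirashviliSereginSverak2009, Lemma 3.1 and Remark 6.1] -/
theorem stub_clockSlackLiouville :
    ∀ (C : ℝ) (v : ℝ → EuclideanSpace ℝ (Fin 3) → EuclideanSpace ℝ (Fin 3)),
      IsTypeIAncientMild C v →
      ∀ (Λ : ℝ → ℝ), Continuous Λ →
        (∀ t : ℝ, t < 0 → ∀ (x ξ : EuclideanSpace ℝ (Fin 3)),
          ⟪fderiv ℝ (v t) x ξ, ξ⟫ ≤ Λ t * ‖ξ‖ ^ 2) →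
        (∃ ε K : ℝ, 0 < ε ∧ ∀ t₀ t₁ : ℝ, t₀ < t₁ → t₁ < 0 →
          ∫ t in t₀..t₁, Λ t ≤ (1 - ε) * Real.log (t₀ / t₁) + K) →
        ∀ t : ℝ, t < 0 → ∀ x : EuclideanSpace ℝ (Fin 3), v t x = 0 := by
  intro C v hv Λ hΛ hmaj hslack
  obtain ⟨ε, K, hε, hsl⟩ := hslack
  refine clockSL_eq_zero_of_constantin hv (Λ := Λ) (fun t₀ t₁ h01 h1 A hA x => ?_) hε hsl
  exact stub_clockConstantinWindow C v hv t₀ t₁ h01 h1 Λ hΛ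
    (fun t ht y ξ => hmaj t (ht.2.trans_lt h1) y ξ) A hA x

end Summit.NavierStokesRegularity.NavierStokesRegularity.Theorems

end
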